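import Literature.MathematicalPhysics.QuantumFieldTheory.Balaban1983to89.HiggsFluctMeasurePos

/-!
# `Balaban1983to89.HiggsFluctMeasureExpMoments` — T. Bałaban, *(Higgs)₂,₃ quantum fields in a finite volume. I. A lower
bound*, Commun. Math. Phys. **85** (1982) 603–626 [Balaban1982Higgs1] p. 617: *"The fields A′_j defining the components
of (3.33) are independent Gaussian random variables with the covariances C^{(j),L^jε}"* — **EXPONENTIAL (hence ALL
POLYNOMIAL) MOMENTS of the concrete fluctuation measures `dμ_{C^{(j),L^jη}}(A′_j)` and of their product
`Π_{j<k} dμ_{C^{(j),L^jη}}` of III (1.4) p. 412** (`…HiggsFluctMeasure.fluctMeasure`, `fluctFamily`): for every real `t`,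
`∫ e^{t‖A′‖} dμ_{C^{(j)}}(A′) < ∞` and `∫ e^{t‖A′‖} Π_j dμ_{C^{(j)}}(A′_j) < ∞` (sup norms of bond functions), so
`‖A′‖^p` is integrable for every `p` — regime `m² > 0` (vector mass `msq > 0`), `a > 0`, `L > 1`, levels `≤ K`; theorems
only.  The input every `e′`-derivative of the renormalization transformation (1.4) needs: differentiating the transports
`U(e′g_kA′(Γ))` in the charge brings down factors linear in the fluctuation fields `A′`, whose integrability against
`Π_j dμ_{C^{(j)}}` is this file (companion of the typer's `B3Eq14Finite`/`B3Eq14LamAllOrders`, which treat the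
`λ′`-direction where no such factors occur).

statement-level skeleton of published theorems with citation tags; proofs where landed; nothing here is a claim about
the Yang–Mills mass gap

THE ARGUMENT (ours; the paper states the Gaussian character without proof — for a centred Gaussian measure on a
finite-dimensional space exponential moments are standard).  By the coercivity
`c·Σ_b A′_b² ≤ ⟨A′,(C^{(j)})^{−1}A′⟩` (`HiggsFluctMeasurePos.exists_quadForm_ge`) the weight is dominated by
`Π_b e^{−(c/2)A′_b²}`; with `‖A′‖ ≤ Σ_b|A′_b|` and the one-dimensional completion of the square
`|t||x| − (c/2)x² ≤ t²/c − (c/4)x²`, `e^{t‖A′‖}·e^{−½⟨A′,(C^{(j)})^{−1}A′⟩} ≤ Π_b e^{t²/c}e^{−(c/4)A′_b²}`, a product of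
integrable one-dimensional Gaussians (`integrable_exp_mul_norm_mul_gaussWeight`); the normalised density measure
inherits the bound (`integrable_exp_mul_norm_fluctMeasure`), `‖A′‖^p ≤ p!·e^{‖A′‖}` gives the polynomial moments
(`integrable_norm_pow_fluctMeasure`), and on the product `‖(A′_j)_j‖ ≤ Σ_j‖A′_j‖` reduces the family to a product of
one-field exponential moments (`MeasureTheory.Integrable.fintype_prod_dep`; `integrable_exp_mul_norm_fluctFamily`,
`integrable_norm_pow_fluctFamily`, `integrable_polyGrowth_fluctFamily`).

PDF held: `paper:balaban1982-cmp85-higgs23-i` (journal page = PDF page + 602); p. 617 [PDF 15] (render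
`run/shared/lean/pub/pub-balaban/b2b-balaban-ref1/pages/1982-cmp85-higgs23-I/…-p015-x2.png`); III p. 412 (1.4).

CITATION HEADER (lean-in-tree rule).  lit-balaban typed skeleton (HOME `run/shared/lean/pub/lit-balaban/`), typer
line, companion of the carrier `HiggsFluctMeasure` (row **B3.Eq1.4**, owner r15; no row changes head — integrability
facts about the typed measures).  Unit `lit-balaban-typer` gen 26 (literature-prover-lit-balaban-typer-g26-0).
-/

open scoped BigOperators ENNReal
open _root_.MeasureTheory

namespace Literature.MathematicalPhysics.QuantumFieldTheory.Balaban1983to89.HiggsFluctMeasureExpMoments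

open Literature.MathematicalPhysics.QuantumFieldTheory.Balaban1983to89.HiggsLattice
open Literature.MathematicalPhysics.QuantumFieldTheory.Balaban1983to89.HiggsFluctMeasure
open Literature.MathematicalPhysics.QuantumFieldTheory.Balaban1983to89.HiggsFluctMeasurePos
open Set Filter Topology

noncomputable section

variable {P : Params}

/-! ## 1. One field: `∫ e^{t‖A′‖} e^{−½⟨A′,(C^{(j)})^{−1}A′⟩} dA′ < ∞` -/

/-- Completing the square in one variable: `e^{t|x| − (c/2)x²} ≤ e^{t²/c}·e^{−(c/4)x²}` (`c > 0`). [folklore] -/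
private theorem exp_lin_sub_sq_le {c : ℝ} (hc : 0 < c) (t x : ℝ) :
    Real.exp (t * |x| + -(c / 2) * x ^ 2) ≤ Real.exp (t ^ 2 / c) * Real.exp (-(c / 4) * x ^ 2) := by
  rw [← Real.exp_add, Real.exp_le_exp]
  have hx : |x| ^ 2 = x ^ 2 := sq_abs x
  have h1 : 0 ≤ (c / 2 * |x| - t) ^ 2 := sq_nonneg _
  have h2 : (c / 2 * |x| - t) ^ 2 = c * (c / 4 * x ^ 2) - c * (t * |x|) + t ^ 2 := by
    linear_combination (c ^ 2 / 4) * hx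
  have h3 : c * (t ^ 2 / c) = t ^ 2 := by field_simp
  have h4 : c * (t * |x|) ≤ c * (c / 4 * x ^ 2 + t ^ 2 / c) := by
    rw [mul_add, h3]
    linarith [h1, h2]
  have h5 := le_of_mul_le_mul_left h4 hc
  linarith

/-- The sup norm of a bond function is at most the sum of the absolute values of its entries. [folklore] -/
private theorem norm_le_sum_abs {j : ℕ} (A : VecField P j) : ‖A‖ ≤ ∑ b : PBond P j, |A b| := by
  refine (pi_norm_le_iff_of_nonneg (Finset.sum_nonneg fun _ _ => abs_nonneg _)).2 fun b => ?_
  rw [Real.norm_eq_abs]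
  exact Finset.single_le_sum (fun b' _ => abs_nonneg (A b')) (Finset.mem_univ b)

/-- **Exponential moments of the Gaussian weight**: `A′ ↦ e^{t‖A′‖}·exp(−½⟨A′,(C^{(j),L^jη})^{−1}A′⟩)` is Lebesgue
integrable on the bond functions of `T^{(j)}`, for every real `t` (`msq > 0`, `a > 0`, `L > 1`, `j ≤ K`).
[cite: Balaban1982Higgs1, (3.35) p.618] -/
theorem integrable_exp_mul_norm_mul_gaussWeight {msq a : ℝ} (hmsq : 0 < msq) (ha : 0 < a) (hL : 1 < (P.L : ℝ))
    {j : ℕ} (hj : j ≤ P.K) (t : ℝ) :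
    Integrable (fun A : VecField P j => Real.exp (t * ‖A‖) * gaussWeight P msq a j A) := by
  obtain ⟨c, hc, hbound⟩ := exists_quadForm_ge hmsq ha hL hj
  have hg : Integrable (fun A : VecField P j =>
      ∏ b : PBond P j, (Real.exp (|t| ^ 2 / c) * Real.exp (-(c / 4) * A b ^ 2))) := by
    have h := Integrable.fintype_prod (ι := PBond P j)
      (f := fun (_ : PBond P j) (x : ℝ) => Real.exp (|t| ^ 2 / c) * Real.exp (-(c / 4) * x ^ 2))
      (μ := fun _ => (volume : Measure ℝ))
      (fun _ => (integrable_exp_neg_mul_sq (by positivity : 0 < c / 4)).const_mul _)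
    simpa [volume_pi] using h
  have hmeas : AEStronglyMeasurable (fun A : VecField P j => Real.exp (t * ‖A‖) * gaussWeight P msq a j A) volume :=
    ((continuous_const.mul continuous_norm).rexp.mul (continuous_gaussWeight msq a j)).aestronglyMeasurable
  refine hg.mono' hmeas (Filter.Eventually.of_forall fun A => ?_)
  rw [Real.norm_of_nonneg (mul_nonneg (Real.exp_pos _).le (gaussWeight_nonneg msq a j A))]
  have h1 : t * ‖A‖ ≤ |t| * ∑ b : PBond P j, |A b| :=
    (mul_le_mul_of_nonneg_right (le_abs_self t) (norm_nonneg _)).trans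
      (mul_le_mul_of_nonneg_left (norm_le_sum_abs A) (abs_nonneg t))
  have h2 : gaussWeight P msq a j A ≤ Real.exp (-(c / 2) * ∑ b : PBond P j, A b ^ 2) := by
    rw [gaussWeight_eq, Real.exp_le_exp]
    have := hbound A
    nlinarith
  calc Real.exp (t * ‖A‖) * gaussWeight P msq a j A
      ≤ Real.exp (|t| * ∑ b : PBond P j, |A b|) * Real.exp (-(c / 2) * ∑ b : PBond P j, A b ^ 2) :=
        mul_le_mul (Real.exp_le_exp.2 h1) h2 (gaussWeight_nonneg msq a j A) (Real.exp_pos _).le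
    _ = ∏ b : PBond P j, Real.exp (|t| * |A b| + -(c / 2) * A b ^ 2) := by
        rw [← Real.exp_add, ← Real.exp_sum, Finset.mul_sum, Finset.mul_sum, ← Finset.sum_add_distrib]
    _ ≤ ∏ b : PBond P j, (Real.exp (|t| ^ 2 / c) * Real.exp (-(c / 4) * A b ^ 2)) :=
        Finset.prod_le_prod (fun b _ => (Real.exp_pos _).le) fun b _ => exp_lin_sub_sq_le hc |t| (A b)

/-- **Exponential moments of `dμ_{C^{(j),L^jη}}`**: `∫ e^{t‖A′‖} dμ_{C^{(j)}}(A′) < ∞` for every real `t` (`msq > 0`, `a > 0`,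
`L > 1`, `j ≤ K`). [cite: Balaban1982Higgs1, p.617] -/
theorem integrable_exp_mul_norm_fluctMeasure {msq a : ℝ} (hmsq : 0 < msq) (ha : 0 < a) (hL : 1 < (P.L : ℝ))
    {j : ℕ} (hj : j ≤ P.K) (t : ℝ) :
    Integrable (fun A : VecField P j => Real.exp (t * ‖A‖)) (fluctMeasure P msq a j) := by
  rw [fluctMeasure_eq]
  refine Integrable.smul_measure ?_ (ENNReal.inv_ne_top.2 (ENNReal.ofReal_pos.2 (gaussNorm_pos hmsq ha hL hj)).ne')
  rw [integrable_withDensity_iff (measurable_gaussWeight msq a j).ennreal_ofReal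
    (Filter.Eventually.of_forall fun _ => ENNReal.ofReal_lt_top)]
  refine (integrable_exp_mul_norm_mul_gaussWeight hmsq ha hL hj t).congr (Filter.Eventually.of_forall fun A => ?_)
  show Real.exp (t * ‖A‖) * gaussWeight P msq a j A = Real.exp (t * ‖A‖) * (ENNReal.ofReal (gaussWeight P msq a j A)).toReal
  rw [ENNReal.toReal_ofReal (gaussWeight_nonneg msq a j A)]

/-- **Polynomial moments of `dμ_{C^{(j),L^jη}}`**: `∫ ‖A′‖^p dμ_{C^{(j)}}(A′) < ∞` for every `p` (`‖A′‖^p ≤ p!·e^{‖A′‖}`).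
[cite: Balaban1982Higgs1, p.617] -/
theorem integrable_norm_pow_fluctMeasure {msq a : ℝ} (hmsq : 0 < msq) (ha : 0 < a) (hL : 1 < (P.L : ℝ))
    {j : ℕ} (hj : j ≤ P.K) (p : ℕ) :
    Integrable (fun A : VecField P j => ‖A‖ ^ p) (fluctMeasure P msq a j) := by
  have h := (integrable_exp_mul_norm_fluctMeasure hmsq ha hL hj 1).const_mul (Nat.factorial p : ℝ)
  refine h.mono' (continuous_norm.pow p).aestronglyMeasurable (Filter.Eventually.of_forall fun A => ?_)
  rw [Real.norm_of_nonneg (pow_nonneg (norm_nonneg _) _), one_mul]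
  have h1 := Real.pow_div_factorial_le_exp ‖A‖ (norm_nonneg _) p
  rwa [div_le_iff₀ (by positivity), mul_comm] at h1

/-! ## 2. The family: `∫ e^{t‖(A′_j)_j‖} Π_{j<k} dμ_{C^{(j),L^jη}}(A′_j) < ∞` -/

/-- The sup norm of a family is at most the sum of the norms of its members. [folklore] -/
private theorem norm_family_le_sum {k : ℕ} (A' : (i : Fin k) → VecField P i) : ‖A'‖ ≤ ∑ j : Fin k, ‖A' j‖ :=
  (pi_norm_le_iff_of_nonneg (Finset.sum_nonneg fun _ _ => norm_nonneg _)).2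
    fun j => Finset.single_le_sum (fun j' _ => norm_nonneg (A' j')) (Finset.mem_univ j)

/-- **Exponential moments of the product measure `Π_{j<k} dμ_{C^{(j),L^jη}}`** (the independent Gaussian fluctuation
fields of p. 617, III (1.4)): `∫ e^{t‖A′‖} Π_j dμ_{C^{(j)}}(A′_j) < ∞` for every real `t` and `k ≤ K`.
[cite: Balaban1983Higgs3, (1.4) p.412] -/
theorem integrable_exp_mul_norm_fluctFamily {msq a : ℝ} (hmsq : 0 < msq) (ha : 0 < a) (hL : 1 < (P.L : ℝ))
    {k : ℕ} (hk : k ≤ P.K) (t : ℝ) :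
    Integrable (fun A' : (j : Fin k) → VecField P j => Real.exp (t * ‖A'‖)) (fluctFamily P msq a k) := by
  have hjK : ∀ j : Fin k, (j : ℕ) ≤ P.K := fun j => (Nat.le_of_lt j.isLt).trans hk
  haveI : ∀ j : Fin k, IsProbabilityMeasure (fluctMeasure P msq a j) :=
    fun j => fluctMeasure_isProbability hmsq ha hL (hjK j)
  have hprod : Integrable (fun A' : (j : Fin k) → VecField P j => ∏ j : Fin k, Real.exp (|t| * ‖A' j‖))
      (fluctFamily P msq a k) := by
    rw [fluctFamily_eq]
    exact Integrable.fintype_prod_dep (f := fun (j : Fin k) (A : VecField P j) => Real.exp (|t| * ‖A‖))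
      fun j => integrable_exp_mul_norm_fluctMeasure hmsq ha hL (hjK j) |t|
  refine hprod.mono' (continuous_const.mul continuous_norm).rexp.aestronglyMeasurable
    (Filter.Eventually.of_forall fun A' => ?_)
  rw [Real.norm_of_nonneg (Real.exp_pos _).le, ← Real.exp_sum, Real.exp_le_exp, ← Finset.mul_sum]
  exact (mul_le_mul_of_nonneg_right (le_abs_self t) (norm_nonneg _)).trans
    (mul_le_mul_of_nonneg_left (norm_family_le_sum A') (abs_nonneg t))

/-- **Polynomial moments of the product measure**: `∫ ‖A′‖^p Π_j dμ_{C^{(j)}}(A′_j) < ∞` for every `p` and `k ≤ K`.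
[cite: Balaban1983Higgs3, (1.4) p.412] -/
theorem integrable_norm_pow_fluctFamily {msq a : ℝ} (hmsq : 0 < msq) (ha : 0 < a) (hL : 1 < (P.L : ℝ))
    {k : ℕ} (hk : k ≤ P.K) (p : ℕ) :
    Integrable (fun A' : (j : Fin k) → VecField P j => ‖A'‖ ^ p) (fluctFamily P msq a k) := by
  have h := (integrable_exp_mul_norm_fluctFamily hmsq ha hL hk 1).const_mul (Nat.factorial p : ℝ)
  refine h.mono' (continuous_norm.pow p).aestronglyMeasurable (Filter.Eventually.of_forall fun A' => ?_)
  rw [Real.norm_of_nonneg (pow_nonneg (norm_nonneg _) _), one_mul]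
  have h1 := Real.pow_div_factorial_le_exp ‖A'‖ (norm_nonneg _) p
  rwa [div_le_iff₀ (by positivity), mul_comm] at h1

/-- **Functions of polynomial growth in the fluctuation family are integrable**: if `f` is (strongly) measurable and
`|f(A′)| ≤ C·(1 + ‖A′‖)^p` then `∫ |f| Π_j dμ_{C^{(j)}} < ∞` (`k ≤ K`) — the form in which the `e′`-derivatives of
(1.4) use the moments. [cite: Balaban1983Higgs3, (1.4) p.412] -/
theorem integrable_of_polyGrowth_fluctFamily {msq a : ℝ} (hmsq : 0 < msq) (ha : 0 < a) (hL : 1 < (P.L : ℝ))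
    {k : ℕ} (hk : k ≤ P.K) {f : ((j : Fin k) → VecField P j) → ℝ}
    (hf : AEStronglyMeasurable f (fluctFamily P msq a k)) {C : ℝ} {p : ℕ}
    (hle : ∀ A', |f A'| ≤ C * (1 + ‖A'‖) ^ p) :
    Integrable f (fluctFamily P msq a k) := by
  haveI := fluctFamily_isProbability (P := P) hmsq ha hL hk
  -- `(1 + ‖A′‖)^p ≤ 2^p (1 + ‖A′‖^p)`? simpler: `(1 + ‖A′‖)^p ≤ p!·e^{1 + ‖A′‖}`
  have hexp := (integrable_exp_mul_norm_fluctFamily hmsq ha hL hk 1).const_mul (|C| * (Nat.factorial p : ℝ) * Real.exp 1)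
  refine hexp.mono' hf (Filter.Eventually.of_forall fun A' => ?_)
  rw [Real.norm_eq_abs, one_mul]
  have h0 : 0 ≤ 1 + ‖A'‖ := by positivity
  have h1 := Real.pow_div_factorial_le_exp (1 + ‖A'‖) h0 p
  rw [div_le_iff₀ (by positivity), Real.exp_add] at h1
  calc |f A'| ≤ C * (1 + ‖A'‖) ^ p := hle A'
    _ ≤ |C| * (1 + ‖A'‖) ^ p := mul_le_mul_of_nonneg_right (le_abs_self C) (pow_nonneg h0 p)
    _ ≤ |C| * (Real.exp 1 * Real.exp ‖A'‖ * (Nat.factorial p : ℝ)) := mul_le_mul_of_nonneg_left h1 (abs_nonneg C)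
    _ = |C| * (Nat.factorial p : ℝ) * Real.exp 1 * Real.exp ‖A'‖ := by ring

end

end Literature.MathematicalPhysics.QuantumFieldTheory.Balaban1983to89.HiggsFluctMeasureExpMoments
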